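import Summits.KontsevichZagierPeriods.StrongHypotheses
import Summits.KontsevichZagierPeriods.KontsevichZagierPeriods.Theses.LiftingCriteria

/-!
# Redirect r1 (crux-strategist), crux stmt-KontsevichZagierPeriods-3572 `DilationTransfer`: the converse direction S → C

`KontsevichZagierPeriods → DilationTransfer`, kernel-checked: the crux is a CONSEQUENCE of the summit
(kernel form of Conjecture 1, `kzKernelConjecture_iff_kontsevichZagierPeriods`, applied to the combination
`m₀·[u] + Σ mᵢ·[rᵢ]`, whose value is the functional relation evaluated at `ϖ = ϖ₀`, i.e. `0`).
Re-derivation of the refuter eread's `Structure.lean` theorem of the same name (evidence on the item,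
2026-08-17T11:26Z), whose file is not readable from this box.
-/

noncomputable section

-- `Summit.KontsevichZagierPeriods.KontsevichZagierPeriods.…` is the tree's mandated layout (single-conjunct summit).
set_option linter.dupNamespace false

open scoped BigOperators
open MeasureTheory Set
open Literature.NumberTheory.Transcendental
open Summit.KontsevichZagierPeriods.KontsevichZagierPeriods.Theses.LiftingCriteria (DilationTransfer)

namespace Summit.KontsevichZagierPeriods.KontsevichZagierPeriods.Cruxes.DilationTransfer.RedirectR1

/-- The unit representation `[pt, 1]` has value `1`. [folklore] -/
theorem value_unit {u : KZ.IntegralRep 0} (hu1 : u.domain = Set.univ) (hu2 : ∀ x, u.integrand x = 1) :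
    u.value = 1 := by
  have hvol : volume (Set.univ : Set (Fin 0 → ℝ)) = 1 := by
    rw [volume_pi, Measure.pi_univ]; simp
  have hint : u.integrand = fun _ => (1:ℝ) := funext hu2
  rw [KZ.IntegralRep.value, hu1, hint, setIntegral_const]
  simp [Measure.real, hvol]

/-- A cube representation of `z ↦ g (ϖ₀ • z)` has the dilation value as its value. [folklore] -/
theorem value_cube {N : ℕ} {h : (Fin N → ℝ) → ℝ} {r : KZ.IntegralRep N}
    (hr1 : r.domain = Set.pi Set.univ (fun _ : Fin N => Set.Icc (0:ℝ) 1))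
    (hr2 : ∀ z ∈ Set.pi Set.univ (fun _ : Fin N => Set.Icc (0:ℝ) 1), r.integrand z = h z) :
    r.value = ∫ z in Set.pi Set.univ (fun _ : Fin N => Set.Icc (0:ℝ) 1), h z := by
  rw [KZ.IntegralRep.value, hr1]
  exact setIntegral_congr_fun (MeasurableSet.univ_pi fun _ => measurableSet_Icc) hr2

/-- **S → C.** The summit implies the crux `DilationTransfer`. [cite: KontsevichZagier2001, §1.2 Conjecture 1] -/
theorem dilationTransfer_of_kontsevichZagierPeriods (h : KontsevichZagierPeriods) : DilationTransfer := by
  intro S n g U hg m m₀ ϖ₀ hpos hle hw r u hr hu1 hu2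
  obtain ⟨T, d, G, V, μ, μ₀, hG, hμ, hμ₀, hfun⟩ := hw
  have hK : KZKernelConjecture :=
    Summit.KontsevichZagierPeriods.StrongHypotheses.kzKernelConjecture_iff_kontsevichZagierPeriods.mpr h
  apply hK
  have hmem : ((ϖ₀ : ℚ) : ℝ) ∈ Set.Icc (0:ℝ) 1 :=
    ⟨by exact_mod_cast hpos.le, by exact_mod_cast hle⟩
  have h0 := hfun (ϖ₀ : ℝ) hmem
  rw [sub_self, zero_mul] at h0
  have hval : ∀ i, (r i).value =
      ∫ z in Set.pi Set.univ (fun _ : Fin (n i) => Set.Icc (0:ℝ) 1), g i ((ϖ₀ : ℝ) • z) :=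
    fun i => value_cube (hr i).1 (hr i).2
  simp only [map_add, map_sum, map_zsmul, KZ.eval_of, zsmul_eq_mul, hval, value_unit hu1 hu2, mul_one]
  exact h0

end Summit.KontsevichZagierPeriods.KontsevichZagierPeriods.Cruxes.DilationTransfer.RedirectR1
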